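import Literature.AlgebraicGeometry.AbelianSchemes.MumfordBundleTranslationStabilizer
import Literature.AlgebraicGeometry.AbelianSchemes.RigidDescentAlongUnitSectionOfBaseChange
import Literature.AlgebraicGeometry.AbelianSchemes.AbelianSchemeKOfLLocal
import Literature.AlgebraicGeometry.AbelianSchemes.RigidifyAlongUnitSlice
import Literature.AlgebraicGeometry.AbelianSchemes.RigidifiedLineBundleComap
import HarnessLib

/-!
# The normalised `K`-linearisation of Mumford's bundle `Λ(L)` for the action `1 × t_•` of a finite `K ≤ K(L)(S)`

Layer `Literature/AlgebraicGeometry/AbelianSchemes`, namespace `Literature.AlgebraicGeometry.AbelianSchemes.AbelianSchemeOver`.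
THEOREMS ONLY (no definition, no named fact, no instance, no notation, no `sorry`; net Literature debt 0).

Source: [MumfordAV1970] §13, proof of the Theorem p. 125 («the action of `K(L)` on the second factor of `X × X` LIFTS to
`Λ(L)`», the lift being pinned down by the normalisation `Λ(L)|_{{0} × X}` trivial); §8 pp. 78–80 (the same normalisation in
characteristic `0`); [MumfordFogartyKirwan1994] Ch. 1 §3 Def. 1.6 (p. 30) (`G`-linearisations); [MilneAV2008] I §8 (p. 40).
RELATIVE to a base: `A → S` an abelian scheme over a locally Noetherian `S` (NOT assumed reduced), `L` a rank-one module on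
`A` rigidified along the unit section, `K ≤ A(S)` a finite group of sections contained in `K(L)(S)` (★ `MemKOfL`), `ρ = 1 × t_•`
the translation action on the second factor of `A ×_S A` over `1 × π : A ×_S A → A ×_S (A⁄K)` (★
`AbelianSchemeQuotientDualSideAction.prodTranslationActionOver A A u K hcov`):

* §1 `nonempty_pullback_unitSection_baseChange_self_mumfordBundle_iso` — `Λ(L)` is rigidified along the unit section
  `(ε, id) : A → A ×_S A` of `A_A → A` (second factor): ★ `nonempty_pullback_unitSlice_mumfordBundle_iso` through ★
  `unitSection_baseChange_eq_unitSlice`.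
* §2 **`exists_equivariantStructure_mumfordBundle_restrictAlong_eq`** — THE NORMALISED LINEARISATION: for every
  rigidification `e : (ε, id)^*Λ(L) ≅ 𝒪_A` there is a `K`-linearisation `Φ` of `Λ(L)` for `ρ` whose restriction along the
  (equivariant, ★ `translationActionOver_autHom_comp_unitSection_baseChange`) unit section is the TRIVIAL linearisation of
  `𝒪_A = (A → Y)^*𝒪_Y` transported by `e` — RIGID DESCENT along the unit section of the base change `A_A = A.baseChange (A → S)`
  over an ARBITRARY (non-reduced) parameter scheme (★ `exists_equivariantStructure_of_restrictAlong_unitSection_baseChange`,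
  B-p13 (g21)), fed with the stabiliser isomorphisms `(1 × t_σ)^*Λ(L) ≅ Λ(L)`, `σ ∈ K` (★
  `nonempty_pullback_prodTranslationActionOver_autHom_mumfordBundle_iso`); `…_unique` — it is unique;
  **`nonempty_equivariantStructure_mumfordBundle`** — hence SOME `K`-linearisation of `Λ(L)` exists: the input `Φ` of ★ (β)/(T1)
  descent along `1 × π` (`MumfordQuotientPoincare.exists_rigidified_descent_mumfordBundle`).

Cell `hodgecm-mathlib` (D-0151), FLOOR 0 programme P1, sub-line `Cruxes/HDel/Lines/F3DualAbelianScheme`, stub (M), inner step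
(M-b) (child line `F3DualAbelianSchemeM`, letter `stub_F3Mb`); piece (b2) of the census
`B-provers/B-p16/g18/CENSUS-F3Mb-ConstantKQuotientPoincare.B-p16g18.md`.  `[IsCommMonObj A.X]` is a binder (★
`isCommMonObj_of_isLocallyNoetherian_base` discharges it for every abelian scheme over a locally Noetherian base).
Count-neutral; HC_CM is proved only modulo the 7 printed citations until rung 0 closes; nothing here is about HC.

Mathlib searched (pin): `Exists.choose_spec`, `Nonempty.some`; Mathlib has no abelian schemes and no linearisations.

## References
* [MumfordAV1970] D. Mumford, *Abelian Varieties* (1970), §8 pp. 78–80, §13 (Thm. p. 125 and its proof).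
* [MumfordFogartyKirwan1994] D. Mumford, J. Fogarty, F. Kirwan, *GIT* 3rd ed. (1994), Ch. 1 §3 Def. 1.6 (p. 30); Ch. 6 §2 (p. 121).
* [MilneAV2008] J. S. Milne, *Abelian Varieties* (v2.00, 2008), I §8 p. 40.
-/

set_option autoImplicit false

noncomputable section

-- `Scheme.Modules` / `SheafOfModules` are not reducible; `(A.X ⊗ A.X).left = (A.baseChange A.X.hom).X.left` holds by `rfl` only.
set_option backward.isDefEq.respectTransparency false

universe u

open CategoryTheory CategoryTheory.Limits AlgebraicGeometry MonoidalCategory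
open scoped MonObj

namespace Literature.AlgebraicGeometry.AbelianSchemes

open Literature.AlgebraicGeometry.RelativeSpec Literature.AlgebraicGeometry.Modules
  Literature.AlgebraicGeometry.Motives Literature.AlgebraicGeometry.AbelianVarieties

namespace AbelianSchemeOver

variable {S : Scheme.{u}} [IsLocallyNoetherian S] (A : AbelianSchemeOver S) [IsCommMonObj A.X]
  {Y : Scheme.{u}} (u : S ⟶ Y) (K : Subgroup A.Sections) [Finite K] [Y.IsSeparated] [IsSeparated (A.X.hom ≫ u)] [S.IsSeparated]
  (hcov : ∀ x : A.left, ∃ O : (A.translationActionOver u K).StableAffineOpens, x ∈ O.1)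
  {L : A.left.Modules} (hL : HasRank L 1)
  (hε : CechPic.pullback A.unitSection (detClass (HasRank.isFiniteLocallyFree' hL)) = 1)
  (hKL : ∀ k : K, A.MemKOfL L (k : A.Sections))

/-! ## §1 `Λ(L)` is rigidified along the unit section of `A_A → A` -/

omit [IsLocallyNoetherian S] [IsCommMonObj A.X] [S.IsSeparated] in
include hε in
/-- **`(ε, id)^*Λ(L) ≅ 𝒪_A`**: Mumford's bundle is rigidified along the unit section of the base change `A_A = A ×_S A → A`
(second factor) — ★ `nonempty_pullback_unitSlice_mumfordBundle_iso` (`(ε × 1)^*Λ ≅ 𝒪` for `L` rigidified) read through ★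
`unitSection_baseChange_eq_unitSlice`. [cite: MumfordAV1970, §13 (Thm. p. 125, proof: `Λ(L)|_{{0}×X}` is trivial)]
[cite: MumfordFogartyKirwan1994, Ch. 6 §2 (p. 121)] -/
theorem nonempty_pullback_unitSection_baseChange_self_mumfordBundle_iso :
    Nonempty ((Scheme.Modules.pullback (A.baseChange A.X.hom).unitSection).obj (A.mumfordBundle L) ≅
      SheafOfModules.unit _) := by
  rw [unitSection_baseChange_eq_unitSlice A A]
  exact A.nonempty_pullback_unitSlice_mumfordBundle_iso hL hε

/-! ## §2 The normalised `K`-linearisation of `Λ(L)` -/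

include hL hKL in
/-- **THE NORMALISED `K`-LINEARISATION OF `Λ(L)`** ([MumfordAV1970] §13, proof of the Theorem p. 125): for the action
`ρ = 1 × t_•` of a finite `K ≤ K(L)(S)` on `A ×_S A` and ANY rigidification `e : (ε, id)^*Λ(L) ≅ 𝒪_A`, there is a
`K`-linearisation `Φ` of `Λ(L)` whose restriction along the unit section `(ε, id)` of `A_A → A` (equivariant for `t_•` on
`A`, ★ `translationActionOver_autHom_comp_unitSection_baseChange`) is the trivial linearisation of `𝒪_A = (A → Y)^*𝒪_Y`
transported by `e` — rigid descent along the unit section of the base change `A.baseChange (A → S)` over the (possibly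
non-reduced) parameter scheme `A` (★ `exists_equivariantStructure_of_restrictAlong_unitSection_baseChange`), each
`(1 × t_σ)^*Λ(L) ≅ Λ(L)` existing because `σ ∈ K(L)(S)` (★ `nonempty_pullback_prodTranslationActionOver_autHom_mumfordBundle_iso`).
[cite: MumfordAV1970, §13 (Thm. p. 125, proof) and §8 (pp. 78–80)] [cite: MumfordFogartyKirwan1994, Ch. 1 §3 Definition 1.6 (p. 30)] -/
theorem exists_equivariantStructure_mumfordBundle_restrictAlong_eq
    (e : (Scheme.Modules.pullback (A.baseChange A.X.hom).unitSection).obj (A.mumfordBundle L) ≅ SheafOfModules.unit _) :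
    ∃ Φ : (prodTranslationActionOver A A u K hcov).EquivariantStructure (A.mumfordBundle L),
      ∀ k : K, restrictAlong (prodTranslationActionOver A A u K hcov) (A.translationActionOver u K)
          (A.baseChange A.X.hom).unitSection (translationActionOver_autHom_comp_unitSection_baseChange A A u K hcov)
          (A.mumfordBundle L) k (Φ.iso k).hom =
        (((ActionOver.EquivariantStructure.ofPullback (A.translationActionOver u K) (SheafOfModules.unit _)).ofIso
          (RigidifiedLineBundle.pullbackUnitIso (A.X.hom ≫ u) ≪≫ e.symm)).iso k).hom :=
  A.exists_equivariantStructure_of_restrictAlong_unitSection_baseChange A.X.hom (prodTranslationActionOver A A u K hcov)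
    (A.translationActionOver u K) (translationActionOver_autHom_comp_unitSection_baseChange A A u K hcov)
    (A.hasRank_mumfordBundle hL) (A.nonempty_pullback_prodTranslationActionOver_autHom_mumfordBundle_iso u K hcov hL hKL) _

omit [IsCommMonObj A.X] in
include hL in
/-- **Uniqueness of the normalised linearisation**: two `K`-linearisations of `Λ(L)` for `1 × t_•` with the same restriction
along the unit section of `A_A → A` agree (★ `equivariantStructure_iso_eq_of_restrictAlong_eq_baseChange`).
[cite: MumfordAV1970, §13 (Thm. p. 125, proof)] [cite: MumfordFogartyKirwan1994, Ch. 1 §3 Definition 1.6 (p. 30)] -/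
theorem equivariantStructure_mumfordBundle_iso_eq_of_restrictAlong_eq
    (Φ Φ' : (prodTranslationActionOver A A u K hcov).EquivariantStructure (A.mumfordBundle L))
    (h : ∀ k : K, restrictAlong (prodTranslationActionOver A A u K hcov) (A.translationActionOver u K)
          (A.baseChange A.X.hom).unitSection (translationActionOver_autHom_comp_unitSection_baseChange A A u K hcov)
          (A.mumfordBundle L) k (Φ.iso k).hom =
        restrictAlong (prodTranslationActionOver A A u K hcov) (A.translationActionOver u K)
          (A.baseChange A.X.hom).unitSection (translationActionOver_autHom_comp_unitSection_baseChange A A u K hcov)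
          (A.mumfordBundle L) k (Φ'.iso k).hom)
    (k : K) : Φ.iso k = Φ'.iso k :=
  A.equivariantStructure_iso_eq_of_restrictAlong_eq_baseChange A.X.hom (prodTranslationActionOver A A u K hcov)
    (A.translationActionOver u K) (translationActionOver_autHom_comp_unitSection_baseChange A A u K hcov)
    (A.hasRank_mumfordBundle hL) Φ Φ' h k

include hL hε hKL in
/-- **`Λ(L)` admits a `K`-linearisation for `1 × t_•`** (`K ≤ K(L)(S)` finite): the normalised one of
`exists_equivariantStructure_mumfordBundle_restrictAlong_eq` at the rigidification of §1.  This is the input `Φ` of the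
descent of `Λ(L)` along `1 × π` (`MumfordQuotientPoincare.exists_rigidified_descent_mumfordBundle`).
[cite: MumfordAV1970, §13 (Thm. p. 125, proof)] [cite: MilneAV2008, I §8 p. 40] -/
theorem nonempty_equivariantStructure_mumfordBundle :
    Nonempty ((prodTranslationActionOver A A u K hcov).EquivariantStructure (A.mumfordBundle L)) := by
  obtain ⟨e⟩ := A.nonempty_pullback_unitSection_baseChange_self_mumfordBundle_iso hL hε
  obtain ⟨Φ, -⟩ := A.exists_equivariantStructure_mumfordBundle_restrictAlong_eq u K hcov hL hKL e
  exact ⟨Φ⟩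

end AbelianSchemeOver

end Literature.AlgebraicGeometry.AbelianSchemes

end
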